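import Literature.NumberTheory.Rogawski1990.MatchingAdeleGLConj
import Literature.LinearAlgebra.Matrix.IntegralConjugacyOfIdempotents
import HarnessLib

/-!
# Gluing local conjugacies at a SPLIT SEMISIMPLE rational class (two eigenvalues): placewise stable conjugacy to `δ ⊗ 1` IS `GL_N(𝔸_L)`-conjugacy,
# and placewise `U(H)`-conjugacy IS adelic `U(H)(𝔸)`-conjugacy given Kottwitz's a.e. `K_v`-conjugacy clause
(Rogawski, *Automorphic representations of unitary groups in three variables* (1990), §3.3 pp. 21–22, §3.8 Prop. 3.8.1 p. 27, §5.4 p. 72;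
Kottwitz, *Stable trace formula: elliptic singular terms* (1986), Prop. 7.1, Cor. 7.3)

Topic `NumberTheory/Rogawski1990` (§3–§4) on a generic §1–§2 in `Literature.NumberTheory.Automorphic`; THEOREMS ONLY (no definition, no instance,
no named fact, no `sorry`).  Cell `pub/hodgecm-mathlib`, ENGINE T1 (crux H413 = `stmt-HodgeConjecture-24833`), row O7 «singular semisimple classes»
(`CENSUS-O7-SingularClasses.v3` §3 (P3-s)): the SEMISIMPLE twins of ★ `MatchingAdeleGLConj` §1–§3, whose regularity hypothesis
(`charpoly` separable) is replaced by «`(δ − a)(δ − b) = 0` with `a ≠ b` rational» (§1–§3: a singular semisimple `γ ∈ U(H)(L⁺)`, `N = 3`, has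
characteristic polynomial `(X − a)²(X − b)` with `a, b ∈ L`, ★ `SingularSemisimpleElement`) — the integral conjugators at almost every place now come
from ★ `IntegralConjugacyOfIdempotents.exists_units_conj_eq_of_units_conj_map_eq` instead of ★ F1 — and, for the converse gluing in `U(H)(𝔸)` (§4),
by Kottwitz's a.e. `K_v`-conjugacy CLAUSE taken as a HYPOTHESIS in the shape ★ `UnramifiedOrbitalUnitFactorSemisimple` :126–130 consumes
(O7 OWNER WORD #1 (A); discharged for regular `δ` by ★ `eventually_integralConj_of_isRegularElt`, for semisimple `δ` by the K6-α files).

* §1 `exists_mem_glInt_conj_eq_of_mul_sub_eq_zero` — two elements of `GL_N(𝒪_w)` killed by `(X − a)(X − b)`, `a, b ∈ 𝒪_w`, `a − b ∈ 𝒪_wˣ`,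
  conjugate in `GL_N(E_w)`, are `GL_N(𝒪_w)`-conjugate ([Kt₄] Prop. 7.1 for `GL_N` at a split semisimple element).
* §2 `GLn.eventually_exists_mem_glInt_conj_of_forall_isConj_of_mul_sub_eq_zero`, **`GLn.isConj_toAdeleGL_of_isConj_toMixed_of_forall_isConj_of_mul_sub_eq_zero`**
  — `GL_n`-Hasse for a rational `γ` with `(γ − a)(γ − b) = 0`, `a ≠ b ∈ K`: placewise conjugate to `γ ⊗ 1` ⇒ `GL_n(𝔸_K)`-conjugate.
* §3 **`UnitaryGroup.exists_conj_toAdeleGL_eq_of_isStablyConj_of_mul_sub_eq_zero`**, **`MatchingAdeleG₂.exists_gl_conj_eq_adele_of_mul_sub_eq_zero`**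
  — every matching adèle over a split semisimple `γ₀` is `GL₃(𝔸_L)`-conjugate to `γ₀ ⊗ 1` (the adelic `t` of the singular ObsHasse, CENSUS-O7 v3 §3).
* §4 **`UnitaryGroup.isConj_toAdelic_of_isConj_arch_of_forall_isConj_toLocal_of_integralConj`**,
  **`MatchingAdeleG₂.isRationalOver_of_isConj_arch_of_forall_isConj_toLocal_of_integralConj`** — the converse gluing at ANY rational `δ` carrying
  the a.e. `K_v`-conjugacy clause; `…_of_isRegularElt'` recovers ★ R6b from it (consistency).

## References
* J. D. Rogawski, *Automorphic Representations of Unitary Groups in Three Variables*, Ann. of Math. Stud. 123 (1990), §3.3 pp. 21–22, §3.8 p. 27,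
  §5.4 p. 72 [Rogawski1990].
* R. E. Kottwitz, *Stable trace formula: elliptic singular terms*, Math. Ann. 275 (1986), Prop. 7.1, Cor. 7.3 [Kottwitz1986].
-/

set_option autoImplicit false

noncomputable section

open NumberField IsDedekindDomain Filter Polynomial
open scoped Matrix

namespace Literature.NumberTheory.Automorphic

/-! ## §1 `GL_N(𝒪_w)`-conjugacy of two integral split semisimple elements with two unit-separated eigenvalues -/

section GLCore

variable {E : Type} [Field E] [NumberField E] (N : ℕ)

/-- Conjugation commutes with the two-eigenvalue relation: `(P X P⁻¹ − a)(P X P⁻¹ − b) = P (X − a)(X − b) P⁻¹`. [folklore] -/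
private theorem units_conj_sub_smul_mul {R : Type*} [CommRing R] {n : Type*} [Fintype n] [DecidableEq n] (P : (Matrix n n R)ˣ)
    (X : Matrix n n R) (a b : R) :
    ((P : Matrix n n R) * X * ((P⁻¹ : (Matrix n n R)ˣ) : Matrix n n R) - a • (1 : Matrix n n R)) *
        ((P : Matrix n n R) * X * ((P⁻¹ : (Matrix n n R)ˣ) : Matrix n n R) - b • (1 : Matrix n n R)) =
      (P : Matrix n n R) * ((X - a • (1 : Matrix n n R)) * (X - b • (1 : Matrix n n R))) * ((P⁻¹ : (Matrix n n R)ˣ) : Matrix n n R) := by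
  have h : ∀ x : R, (P : Matrix n n R) * (X - x • (1 : Matrix n n R)) * ((P⁻¹ : (Matrix n n R)ˣ) : Matrix n n R) =
      (P : Matrix n n R) * X * ((P⁻¹ : (Matrix n n R)ˣ) : Matrix n n R) - x • (1 : Matrix n n R) := fun x => by
    rw [Matrix.mul_sub, Matrix.sub_mul, Matrix.mul_smul, Matrix.mul_one, Matrix.smul_mul, Units.mul_inv]
  rw [← h a, ← h b]
  simp only [Matrix.mul_assoc]
  rw [← Matrix.mul_assoc ((P⁻¹ : (Matrix n n R)ˣ) : Matrix n n R) (P : Matrix n n R), Units.inv_mul, Matrix.one_mul]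

/-- **Integral conjugacy in `GL_N(E_w)` at a split semisimple element** ([Kt₄] Prop. 7.1 for `GL_N`; «`1 − α(γ)` is `0` or a unit for every
root `α`»): two elements `γ_w, y_w ∈ GL_N(𝒪_w)` (★ `glInt`), conjugate in `GL_N(E_w)`, with `(γ_w − a)(γ_w − b) = 0` for `a, b ∈ 𝒪_w` with
`a − b ∈ 𝒪_wˣ`, satisfy `k γ_w k⁻¹ = y_w` for some `k ∈ GL_N(𝒪_w)` — ★ `exists_units_conj_eq_of_units_conj_map_eq` (idempotent road) on the
integral lifts (★ `mem_range_map_adicCompletionIntegers_iff_mem_glInt`). [cite: Kottwitz1986, Prop. 7.1] [cite: Rogawski1990, §3.3 p. 21] -/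
theorem exists_mem_glInt_conj_eq_of_mul_sub_eq_zero (w : HeightOneSpectrum (𝓞 E)) (γw yw : GL (Fin N) (w.adicCompletion E))
    (hγ : γw ∈ glInt N (w.adicCompletion E)) (hy : yw ∈ glInt N (w.adicCompletion E)) {a b : w.adicCompletionIntegers E}
    (hab : IsUnit (a - b))
    (hγab : (((γw : GL (Fin N) (w.adicCompletion E)) : Matrix (Fin N) (Fin N) (w.adicCompletion E)) -
        (a : w.adicCompletion E) • (1 : Matrix (Fin N) (Fin N) (w.adicCompletion E))) *
      (((γw : GL (Fin N) (w.adicCompletion E)) : Matrix (Fin N) (Fin N) (w.adicCompletion E)) -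
        (b : w.adicCompletion E) • (1 : Matrix (Fin N) (Fin N) (w.adicCompletion E))) = 0)
    (hconj : IsConj γw yw) :
    ∃ k ∈ glInt N (w.adicCompletion E), k * γw * k⁻¹ = yw := by
  have hfinj : Function.Injective (w.adicCompletionIntegers E).subtype := Subtype.val_injective
  have hminj : ∀ {A B : Matrix (Fin N) (Fin N) (w.adicCompletionIntegers E)},
      A.map (w.adicCompletionIntegers E).subtype = B.map (w.adicCompletionIntegers E).subtype → A = B :=
    fun h => Matrix.map_injective hfinj h
  -- integral lifts `γ̃`, `ỹ`
  obtain ⟨γu, hγu⟩ := (mem_range_map_adicCompletionIntegers_iff_mem_glInt N w _).2 hγ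
  obtain ⟨yu, hyu⟩ := (mem_range_map_adicCompletionIntegers_iff_mem_glInt N w _).2 hy
  have hγf : (γu : Matrix (Fin N) (Fin N) (w.adicCompletionIntegers E)).map (w.adicCompletionIntegers E).subtype =
      ((γw : GL (Fin N) (w.adicCompletion E)) : Matrix (Fin N) (Fin N) (w.adicCompletion E)) :=
    congrArg (fun g : GL (Fin N) (w.adicCompletion E) => (g : Matrix (Fin N) (Fin N) (w.adicCompletion E))) hγu
  have hyf : (yu : Matrix (Fin N) (Fin N) (w.adicCompletionIntegers E)).map (w.adicCompletionIntegers E).subtype =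
      ((yw : GL (Fin N) (w.adicCompletion E)) : Matrix (Fin N) (Fin N) (w.adicCompletion E)) :=
    congrArg (fun g : GL (Fin N) (w.adicCompletion E) => (g : Matrix (Fin N) (Fin N) (w.adicCompletion E))) hyu
  -- `map` of `M − c • 1`
  have hmapsub : ∀ (M : Matrix (Fin N) (Fin N) (w.adicCompletionIntegers E)) (c : w.adicCompletionIntegers E),
      (M - c • (1 : Matrix (Fin N) (Fin N) (w.adicCompletionIntegers E))).map (w.adicCompletionIntegers E).subtype =
        M.map (w.adicCompletionIntegers E).subtype - (c : w.adicCompletion E) • (1 : Matrix (Fin N) (Fin N) (w.adicCompletion E)) := by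
    intro M c
    ext i j
    by_cases hij : i = j <;> simp [hij]
  -- `(γ̃ − a)(γ̃ − b) = 0` over `𝒪_w` (injectivity of `M_N(𝒪_w) → M_N(E_w)`)
  have hγab' : ((γu : Matrix (Fin N) (Fin N) (w.adicCompletionIntegers E)) - a • (1 : Matrix (Fin N) (Fin N) (w.adicCompletionIntegers E))) *
      ((γu : Matrix (Fin N) (Fin N) (w.adicCompletionIntegers E)) - b • (1 : Matrix (Fin N) (Fin N) (w.adicCompletionIntegers E))) = 0 := by
    apply hminj
    rw [Matrix.map_mul, hmapsub, hmapsub, hγf, hγab, Matrix.map_zero _ (map_zero _)]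
  -- conjugacy over `E_w` transports the relation to `ỹ`
  obtain ⟨c, hc⟩ := isConj_iff.1 hconj
  have hcm : (c : Matrix (Fin N) (Fin N) (w.adicCompletion E)) *
      (γu : Matrix (Fin N) (Fin N) (w.adicCompletionIntegers E)).map (w.adicCompletionIntegers E).subtype *
        ((c⁻¹ : GL (Fin N) (w.adicCompletion E)) : Matrix (Fin N) (Fin N) (w.adicCompletion E)) =
      (yu : Matrix (Fin N) (Fin N) (w.adicCompletionIntegers E)).map (w.adicCompletionIntegers E).subtype := by
    rw [hγf, hyf, ← Units.val_mul, ← Units.val_mul, hc]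
  have hyab' : ((yu : Matrix (Fin N) (Fin N) (w.adicCompletionIntegers E)) - a • (1 : Matrix (Fin N) (Fin N) (w.adicCompletionIntegers E))) *
      ((yu : Matrix (Fin N) (Fin N) (w.adicCompletionIntegers E)) - b • (1 : Matrix (Fin N) (Fin N) (w.adicCompletionIntegers E))) = 0 := by
    apply hminj
    have h0 : ((γu : Matrix (Fin N) (Fin N) (w.adicCompletionIntegers E)).map (w.adicCompletionIntegers E).subtype -
          (a : w.adicCompletion E) • (1 : Matrix (Fin N) (Fin N) (w.adicCompletion E))) *
        ((γu : Matrix (Fin N) (Fin N) (w.adicCompletionIntegers E)).map (w.adicCompletionIntegers E).subtype -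
          (b : w.adicCompletion E) • (1 : Matrix (Fin N) (Fin N) (w.adicCompletion E))) = 0 := by
      rw [hγf]; exact hγab
    rw [Matrix.map_mul, hmapsub, hmapsub, Matrix.map_zero _ (map_zero _), ← hcm, units_conj_sub_smul_mul, h0, Matrix.mul_zero,
      Matrix.zero_mul]
  -- ★ LA-idem: an integral conjugator
  obtain ⟨g, hg⟩ := Literature.LinearAlgebra.Matrix.exists_units_conj_eq_of_units_conj_map_eq (w.adicCompletionIntegers E).subtype hfinj hab
    hγab' hyab' c hcm
  refine ⟨Matrix.GeneralLinearGroup.map (w.adicCompletionIntegers E).subtype g,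
    (mem_range_map_adicCompletionIntegers_iff_mem_glInt N w _).1 ⟨g, rfl⟩, ?_⟩
  rw [← hγu, ← hyu, ← map_inv, ← map_mul, ← map_mul]
  exact congrArg _ (Units.ext hg)

end GLCore

/-! ## §2 `GL_n`-Hasse at a split semisimple rational class with two eigenvalues -/

section GLGluing

variable {n : ℕ} {K : Type} [Field K] [NumberField K]

/-- **Integral conjugators at almost every place for a split semisimple rational `γ`**: for `γ ∈ GL_n(K)` with `(γ − a)(γ − b) = 0`, `a ≠ b ∈ K`,
and `y ∈ GL_n(𝔸_K)` with `(y_f)_w ∼ γ` in `GL_n(K_w)` for every finite `w`, the conjugators can be taken in `GL_n(𝒪_w)` for almost all `w`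
(where `γ`, `(y_f)_w`, `a`, `b` are `w`-integral and `a − b` is a `w`-unit; §1). [cite: Kottwitz1986, Prop. 7.1, Cor. 7.3]
[cite: Rogawski1990, §3.3 pp. 21–22] -/
theorem GLn.eventually_exists_mem_glInt_conj_of_forall_isConj_of_mul_sub_eq_zero (γ : GL (Fin n) K) {a b : K} (hab : a ≠ b)
    (hγ : (((γ : GL (Fin n) K) : Matrix (Fin n) (Fin n) K) - a • (1 : Matrix (Fin n) (Fin n) K)) *
      (((γ : GL (Fin n) K) : Matrix (Fin n) (Fin n) K) - b • (1 : Matrix (Fin n) (Fin n) K)) = 0)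
    (y : GL (Fin n) (AdeleRing (𝓞 K) K))
    (hv : ∀ w : HeightOneSpectrum (𝓞 K),
      IsConj (Matrix.GeneralLinearGroup.map (algebraMap K (w.adicCompletion K)) γ) (GLn.evalAt n K w (GLn.sndHom n K y))) :
    ∀ᶠ w : HeightOneSpectrum (𝓞 K) in cofinite, ∃ k ∈ glInt n (w.adicCompletion K),
      k * Matrix.GeneralLinearGroup.map (algebraMap K (w.adicCompletion K)) γ * k⁻¹ = GLn.evalAt n K w (GLn.sndHom n K y) := by
  filter_upwards [GLn.eventually_evalAt_mem_glInt (UnitaryGroup.toFinAdeleGL K n γ), GLn.eventually_evalAt_mem_glInt (GLn.sndHom n K y),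
    eventually_mem_adicCompletionIntegers (E := K) a, eventually_mem_adicCompletionIntegers (E := K) b,
    UnitaryGroup.eventually_valued_algebraMap_eq_one (E := K) (sub_ne_zero.2 hab)] with w hγw hyw haw hbw habw
  rw [UnitaryGroup.evalAt_toFinAdeleGL] at hγw
  -- the integral scalars `ã, b̃ ∈ 𝒪_w` with `ã − b̃` a unit
  have hunit : IsUnit ((⟨algebraMap K (w.adicCompletion K) a, haw⟩ : w.adicCompletionIntegers K) - ⟨algebraMap K (w.adicCompletion K) b, hbw⟩) := by
    rw [HeightOneSpectrum.adicCompletionIntegers.isUnit_iff_valued_eq_one]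
    change Valued.v ((algebraMap K (w.adicCompletion K) a - algebraMap K (w.adicCompletion K) b : w.adicCompletion K)) = 1
    rw [← map_sub]
    exact habw
  refine exists_mem_glInt_conj_eq_of_mul_sub_eq_zero n w _ _ hγw hyw hunit ?_ (hv w)
  -- `(γ ⊗ 1 − a)(γ ⊗ 1 − b) = ((γ − a)(γ − b)) ⊗ 1 = 0`
  change ((γ : Matrix (Fin n) (Fin n) K).map (algebraMap K (w.adicCompletion K)) -
      algebraMap K (w.adicCompletion K) a • (1 : Matrix (Fin n) (Fin n) (w.adicCompletion K))) *
    ((γ : Matrix (Fin n) (Fin n) K).map (algebraMap K (w.adicCompletion K)) -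
      algebraMap K (w.adicCompletion K) b • (1 : Matrix (Fin n) (Fin n) (w.adicCompletion K))) = 0
  have hmapsub : ∀ c : K, (((γ : GL (Fin n) K) : Matrix (Fin n) (Fin n) K) - c • (1 : Matrix (Fin n) (Fin n) K)).map
      (algebraMap K (w.adicCompletion K)) =
        (γ : Matrix (Fin n) (Fin n) K).map (algebraMap K (w.adicCompletion K)) -
          algebraMap K (w.adicCompletion K) c • (1 : Matrix (Fin n) (Fin n) (w.adicCompletion K)) := by
    intro c
    rw [Matrix.map_sub _ (map_sub (algebraMap K (w.adicCompletion K))), Matrix.smul_one_eq_diagonal, Matrix.smul_one_eq_diagonal,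
      Matrix.diagonal_map (map_zero _)]
  rw [← hmapsub, ← hmapsub, ← Matrix.map_mul, hγ, Matrix.map_zero _ (map_zero _)]

/-- **`GL_n`-HASSE AT A SPLIT SEMISIMPLE RATIONAL CLASS**: for `γ ∈ GL_n(K)` with `(γ − a)(γ − b) = 0`, `a ≠ b ∈ K`, and `y ∈ GL_n(𝔸_K)` with
`y_∞ ∼ γ ⊗ 1` in `GL_n(K ⊗ ℝ)` and `(y_f)_w ∼ γ` in `GL_n(K_w)` for every finite `w`, `y ∼ γ ⊗ 1` in `GL_n(𝔸_K)` — ★ `GLn.isConj_of_isConj_toMixed_of_forall_exists_conj`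
with its integral clause supplied by `GLn.eventually_exists_mem_glInt_conj_of_forall_isConj_of_mul_sub_eq_zero`.
[cite: Rogawski1990, §3.3 pp. 21–22] [cite: Kottwitz1986, Prop. 7.1] -/
theorem GLn.isConj_toAdeleGL_of_isConj_toMixed_of_forall_isConj_of_mul_sub_eq_zero (γ : GL (Fin n) K) {a b : K} (hab : a ≠ b)
    (hγ : (((γ : GL (Fin n) K) : Matrix (Fin n) (Fin n) K) - a • (1 : Matrix (Fin n) (Fin n) K)) *
      (((γ : GL (Fin n) K) : Matrix (Fin n) (Fin n) K) - b • (1 : Matrix (Fin n) (Fin n) K)) = 0)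
    {y : GL (Fin n) (AdeleRing (𝓞 K) K)} (ha : IsConj (GLn.toMixed n K (toAdeleGL K γ)) (GLn.toMixed n K y))
    (hv : ∀ w : HeightOneSpectrum (𝓞 K),
      IsConj (Matrix.GeneralLinearGroup.map (algebraMap K (w.adicCompletion K)) γ) (GLn.evalAt n K w (GLn.sndHom n K y))) :
    IsConj (toAdeleGL K γ) y := by
  refine GLn.isConj_of_isConj_toMixed_of_forall_exists_conj ha (fun w => ?_) ?_
  · rw [GLn.evalAt_sndHom_toAdeleGL]
    exact hv w
  · filter_upwards [GLn.eventually_exists_mem_glInt_conj_of_forall_isConj_of_mul_sub_eq_zero γ hab hγ y hv] with w hw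
    rw [GLn.evalAt_sndHom_toAdeleGL]
    exact hw

end GLGluing

end Literature.NumberTheory.Automorphic

namespace Literature.NumberTheory.Automorphic.UnitaryGroup

open Literature.NumberTheory.Rogawski1990
open Literature.AlgebraicGeometry.ShimuraVarieties (unitaryGroup)

/-! ## §3 Placewise stable conjugacy to a split semisimple rational `δ` IS `GL_N(𝔸_L)`-conjugacy to `δ ⊗ 1` -/

section CM

variable {L : Type} [Field L] [NumberField L] [IsCMField L] {N : ℕ} {H : Matrix (Fin N) (Fin N) L}

/-- **Placewise stable conjugacy to a split semisimple rational `δ` IS `GL_N(𝔸_L)`-conjugacy**: for `δ ∈ U(H)(L⁺)` with `(δ − a)(δ − b) = 0`,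
`a ≠ b ∈ L`, and `g ∈ U(H)(𝔸)` stably conjugate to `(δ ⊗ 1)_v` at every finite `v` of `L⁺` and to `δ ⊗ 1` at `∞`, there is `x ∈ GL_N(𝔸_L)` with
`x (δ ⊗ 1) x⁻¹ = g` — the semisimple twin of ★ `exists_conj_toAdeleGL_eq_of_isStablyConj` (same proof over §2).
[cite: Rogawski1990, §3.3 pp. 21–22; §3.8 Prop. 3.8.1 p. 27] [cite: Kottwitz1986, Prop. 7.1] -/
theorem exists_conj_toAdeleGL_eq_of_isStablyConj_of_mul_sub_eq_zero {δ : (cmDatum L N H).Rational} {a b : L} (hab : a ≠ b)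
    (hδ : ((((δ : unitaryGroup (cmConjRingHom L) H).val : GL (Fin N) L) : Matrix (Fin N) (Fin N) L) - a • (1 : Matrix (Fin N) (Fin N) L)) *
      ((((δ : unitaryGroup (cmConjRingHom L) H).val : GL (Fin N) L) : Matrix (Fin N) (Fin N) L) - b • (1 : Matrix (Fin N) (Fin N) L)) = 0)
    {g : (cmDatum L N H).Adelic}
    (ha : IsStablyConj (conjMixed (↥(maximalRealSubfield L)) L (IsCMField.complexConj L)) (archFormOf L N H) (cmRationalToArch L N H δ)
      (archPart (↥(maximalRealSubfield L)) L (IsCMField.complexConj L) N H g))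
    (hv : ∀ v : HeightOneSpectrum (𝓞 ↥(maximalRealSubfield L)),
      IsStablyConj (conjLocal L (IsCMField.complexConj L) v) ((adelicForm L N H).map (adeleToLocal L v))
        ((cmDatum L N H).toLocal v ((cmDatum L N H).toAdelic δ)) ((cmDatum L N H).toLocal v g)) :
    ∃ x : GL (Fin N) (AdeleRing (𝓞 L) L),
      x * toAdeleGL L ((δ : unitaryGroup (cmConjRingHom L) H).val : GL (Fin N) L) * x⁻¹ = (g.val : GL (Fin N) (AdeleRing (𝓞 L) L)) := by
  refine isConj_iff.1 (GLn.isConj_toAdeleGL_of_isConj_toMixed_of_forall_isConj_of_mul_sub_eq_zero _ hab hδ ?_ fun w => ?_)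
  · have h1 : GLn.toMixed N L (toAdeleGL L ((δ : unitaryGroup (cmConjRingHom L) H).val : GL (Fin N) L)) =
        ((cmRationalToArch L N H δ : arch (↥(maximalRealSubfield L)) L (IsCMField.complexConj L) N H) : GL (Fin N) (mixedEmbedding.mixedSpace L)) := by
      rw [← archPart_cmDatum_toAdelic]
      rfl
    rw [h1]
    exact ha
  · have h := MonoidHom.map_isConj (Matrix.GeneralLinearGroup.map (Pi.evalRingHom (fun w' : PlacesOver L (placesOver (↥(maximalRealSubfield L)) L w) =>
      w'.1.adicCompletion L) ⟨w, rfl⟩)) (hv (placesOver (↥(maximalRealSubfield L)) L w))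
    rw [map_evalRingHom_coe_toLocal, map_evalRingHom_coe_toLocal] at h
    rw [← GLn.evalAt_sndHom_toAdeleGL]
    exact h

end CM

end Literature.NumberTheory.Automorphic.UnitaryGroup

namespace Literature.NumberTheory.Rogawski1990

open Literature.NumberTheory.Automorphic
open Literature.AlgebraicGeometry.ShimuraVarieties (unitaryGroup)

section Self

variable {L : Type} [Field L] [NumberField L] [IsCMField L] {H : Matrix (Fin 3) (Fin 3) L} {γ₀ : (UnitaryGroup.cmDatum L 3 H).Rational}

/-- **A MATCHING ADÈLE OVER A SPLIT SEMISIMPLE `γ₀` IS `GL₃(𝔸_L)`-CONJUGATE TO `γ₀ ⊗ 1`** (self carrier ★ `MatchingAdeleG₂ L H H γ₀`): for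
`γ₀ ∈ U(H)(L⁺)` with `(γ₀ − a)(γ₀ − b) = 0`, `a ≠ b ∈ L` (e.g. a singular semisimple class, eigenvalues `{a, a, b}`), and `p ∈ 𝒪_st(γ₀ ∕ 𝐀)`,
there is `g ∈ GL₃(𝔸_L)` with `g (γ₀ ⊗ 1) g⁻¹ = p` — the adelic conjugator `t` of the singular obstruction reading (Prop. 3.8.1 (d)).
[cite: Rogawski1990, §3.3 pp. 21–22; §3.8 Prop. 3.8.1 p. 27] [cite: Kottwitz1986, Prop. 7.1] -/
theorem MatchingAdeleG₂.exists_gl_conj_eq_adele_of_mul_sub_eq_zero {a b : L} (hab : a ≠ b)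
    (hγ₀ : ((((γ₀ : unitaryGroup (cmConjRingHom L) H).val : GL (Fin 3) L) : Matrix (Fin 3) (Fin 3) L) - a • (1 : Matrix (Fin 3) (Fin 3) L)) *
      ((((γ₀ : unitaryGroup (cmConjRingHom L) H).val : GL (Fin 3) L) : Matrix (Fin 3) (Fin 3) L) - b • (1 : Matrix (Fin 3) (Fin 3) L)) = 0)
    (p : MatchingAdeleG₂ L H H γ₀) :
    ∃ g : GL (Fin 3) (AdeleRing (𝓞 L) L),
      g * (((UnitaryGroup.cmDatum L 3 H).toAdelic γ₀).val : GL (Fin 3) (AdeleRing (𝓞 L) L)) * g⁻¹ = (p.adele.val : GL (Fin 3) (AdeleRing (𝓞 L) L)) :=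
  UnitaryGroup.exists_conj_toAdeleGL_eq_of_isStablyConj_of_mul_sub_eq_zero hab hγ₀ p.isStablyConj_arch p.isStablyConj_toLocal

/-- The same read as `IsConj` in `GL₃(𝔸_L)`. [cite: Rogawski1990, §3.3 pp. 21–22] -/
theorem MatchingAdeleG₂.isConj_toAdelic_adele_gl_of_mul_sub_eq_zero {a b : L} (hab : a ≠ b)
    (hγ₀ : ((((γ₀ : unitaryGroup (cmConjRingHom L) H).val : GL (Fin 3) L) : Matrix (Fin 3) (Fin 3) L) - a • (1 : Matrix (Fin 3) (Fin 3) L)) *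
      ((((γ₀ : unitaryGroup (cmConjRingHom L) H).val : GL (Fin 3) L) : Matrix (Fin 3) (Fin 3) L) - b • (1 : Matrix (Fin 3) (Fin 3) L)) = 0)
    (p : MatchingAdeleG₂ L H H γ₀) :
    IsConj (((UnitaryGroup.cmDatum L 3 H).toAdelic γ₀).val : GL (Fin 3) (AdeleRing (𝓞 L) L)) (p.adele.val : GL (Fin 3) (AdeleRing (𝓞 L) L)) :=
  isConj_iff.2 (p.exists_gl_conj_eq_adele_of_mul_sub_eq_zero hab hγ₀)

end Self

end Literature.NumberTheory.Rogawski1990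

/-! ## §4 The converse gluing in `U(H)(𝔸)` at ANY rational `δ`, given Kottwitz's a.e. `K_v`-conjugacy clause -/

namespace Literature.NumberTheory.Automorphic.UnitaryGroup

open Literature.NumberTheory.Rogawski1990
open Literature.AlgebraicGeometry.ShimuraVarieties (unitaryGroup)

section Converse

variable (L : Type) [Field L] [NumberField L] [IsCMField L] (N : ℕ) (H : Matrix (Fin N) (Fin N) L)

/-- **THE CONVERSE GLUING AT ANY RATIONAL CLASS**: for `δ ∈ U(H)(L⁺)` carrying Kottwitz's a.e. `K_v`-conjugacy clause `hKδ` («for almost all `v`,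
every `g′ ∈ K_v` stably conjugate to `(δ ⊗ 1)_v` is `K_v`-conjugate to it» — the text of ★ `UnramifiedOrbitalUnitFactorSemisimple` :126–130; ★
`eventually_integralConj_of_isRegularElt` for regular `δ`, the K6-α files for semisimple `δ`) and `g ∈ U(H)(𝔸)` with `g_∞ ∼ δ ⊗ 1` in
`U(H)(L ⊗ ℝ)` and `g_v ∼ (δ ⊗ 1)_v` in `U(H)(L⁺_v)` for every finite `v`: `g ∼ δ ⊗ 1` in `U(H)(𝔸)` — ★ `isConj_of_isConj_archPart_of_forall_exists_conj`
with its «integral conjugators a.e.» clause read off `hKδ` and the a.e. integrality of adelic points (★ `eventually_toLocal_mem_cmLocalIntegralLevel`).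
No hermitian ∕ regularity hypothesis. [cite: Rogawski1990, §3.3 pp. 21–22; §5.4 p. 72] [cite: Kottwitz1986, Prop. 7.1, Cor. 7.3] -/
theorem isConj_toAdelic_of_isConj_arch_of_forall_isConj_toLocal_of_integralConj {δ : (cmDatum L N H).Rational}
    (hKδ : ∀ᶠ v : HeightOneSpectrum (𝓞 ↥(maximalRealSubfield L)) in Filter.cofinite,
      ∀ g' : (cmDatum L N H).Local v, g' ∈ cmLocalIntegralLevel L N H v →
        IsConj (g'.val : GL (Fin N) (LocalRing L v))
          (((cmDatum L N H).toLocal v ((cmDatum L N H).toAdelic δ)).val : GL (Fin N) (LocalRing L v)) →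
          ∃ k ∈ cmLocalIntegralLevel L N H v, k * (cmDatum L N H).toLocal v ((cmDatum L N H).toAdelic δ) * k⁻¹ = g')
    {g : (cmDatum L N H).Adelic}
    (ha : IsConj (cmRationalToArch L N H δ) (archPart (↥(maximalRealSubfield L)) L (IsCMField.complexConj L) N H g))
    (hv : ∀ v : HeightOneSpectrum (𝓞 ↥(maximalRealSubfield L)), IsConj ((cmDatum L N H).toLocal v ((cmDatum L N H).toAdelic δ)) ((cmDatum L N H).toLocal v g)) :
    IsConj ((cmDatum L N H).toAdelic δ) g := by
  refine isConj_of_isConj_archPart_of_forall_exists_conj (↥(maximalRealSubfield L)) L (IsCMField.complexConj L) N H ?_ hv ?_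
  · rw [← archPart_cmDatum_toAdelic] at ha
    exact ha
  · filter_upwards [hKδ, eventually_toLocal_mem_cmLocalIntegralLevel g] with v hP hgv
    refine hP _ hgv ?_
    -- `g_v ∼ (δ ⊗ 1)_v` in `U(H)(L⁺_v)` ⇒ their `GL_N`-values are conjugate
    exact (MonoidHom.map_isConj («local» L (IsCMField.complexConj L) N H v).subtype (hv v)).symm

end Converse

end Literature.NumberTheory.Automorphic.UnitaryGroup

namespace Literature.NumberTheory.Rogawski1990

open Literature.NumberTheory.Automorphic
open Literature.AlgebraicGeometry.ShimuraVarieties (unitaryGroup)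

section SelfConverse

variable {L : Type} [Field L] [NumberField L] [IsCMField L] {H : Matrix (Fin 3) (Fin 3) L} {γ₀ : (UnitaryGroup.cmDatum L 3 H).Rational}

/-- **A matching adèle conjugate to a rational `δ` place by place — in `U(H)(L⁺_v)` at every finite `v` and in `U(H)(L ⊗ ℝ)` at `∞` — is RATIONAL
OVER `δ`**, for ANY `δ` carrying Kottwitz's a.e. `K_v`-conjugacy clause (★ `MatchingAdeleG₂.IsRationalOver`; the (P3-s) of the singular
obstruction count: regularity-free twin of ★ `MatchingAdeleG₂.isRationalOver_of_isConj_arch_of_forall_isConj_toLocal`).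
[cite: Rogawski1990, §3.3 pp. 21–22; §3.8 Prop. 3.8.1 p. 27; §5.4 p. 72] [cite: Kottwitz1986, Prop. 7.1] -/
theorem MatchingAdeleG₂.isRationalOver_of_isConj_arch_of_forall_isConj_toLocal_of_integralConj (p : MatchingAdeleG₂ L H H γ₀)
    {δ : (UnitaryGroup.cmDatum L 3 H).Rational}
    (hKδ : ∀ᶠ v : HeightOneSpectrum (𝓞 ↥(maximalRealSubfield L)) in Filter.cofinite,
      ∀ g' : (UnitaryGroup.cmDatum L 3 H).Local v, g' ∈ UnitaryGroup.cmLocalIntegralLevel L 3 H v →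
        IsConj (g'.val : GL (Fin 3) (UnitaryGroup.LocalRing L v))
          (((UnitaryGroup.cmDatum L 3 H).toLocal v ((UnitaryGroup.cmDatum L 3 H).toAdelic δ)).val : GL (Fin 3) (UnitaryGroup.LocalRing L v)) →
          ∃ k ∈ UnitaryGroup.cmLocalIntegralLevel L 3 H v,
            k * (UnitaryGroup.cmDatum L 3 H).toLocal v ((UnitaryGroup.cmDatum L 3 H).toAdelic δ) * k⁻¹ = g')
    (ha : IsConj (cmRationalToArch L 3 H δ) p.arch)
    (hv : ∀ v : HeightOneSpectrum (𝓞 ↥(maximalRealSubfield L)),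
      IsConj ((UnitaryGroup.cmDatum L 3 H).toLocal v ((UnitaryGroup.cmDatum L 3 H).toAdelic δ)) ((UnitaryGroup.cmDatum L 3 H).toLocal v p.adele)) :
    p.IsRationalOver δ :=
  UnitaryGroup.isConj_toAdelic_of_isConj_arch_of_forall_isConj_toLocal_of_integralConj L 3 H hKδ ha hv

end SelfConverse

end Literature.NumberTheory.Rogawski1990

end
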